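import Mathlib
import HarnessLib
import Summits.PneNP.PneNP.Theorems.CnfIdealGenLengthRankDefectRepresentationsPolyOfAbsoluteMergeLevels

/-!
# Absolute merge with a constant depending on `c` only — Part 1: the assembly (crux `RankDefectRepresentations` =
# stmt-PneNP-18923, line `cell-union-merge`; lead g18)

PART 1 (`assembly`): the algebraic heart of `…CellIndependent.absoluteMerge_cellIndependent` — given the merged coarse
cells on the exceptional blocks, the rank-matched idempotent `E''` and the intertwiner `T P_* T⁻¹ = E''`, the explicitly
defined systems `P'` (transported good cells; coarse cells cut down by `1 − E''`, plus the leftover `E'(1 − E'')`) and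
`Q'_y = Q_y (1 − E'') + T G_y P_* T⁻¹` form a COMMUTING pair of complete orthogonal systems.  Context: for every `c` there is `L = L(c)` such that, over any field of characteristic zero and for
complete orthogonal systems `P : X → K^{d×d}`, `Q : Y → K^{d×d}` of ANY sizes with `rank [P_A, Q_B] ≤ c` for all unions,
there is a COMMUTING pair of complete orthogonal systems `(P', Q')` with `rank (P_A − P'_A) ≤ L`, `rank (Q_B − Q'_B) ≤ L` for
all unions.  The registered lead stub `stub_absoluteMerge` asks for `L = λ·c` with `λ` absolute; here `L(c) = 2^{O(c)}` —
absoluteness in `|X|, |Y|, d` is a THEOREM, linearity in `c` is what stays open (memo `Lines/cell-union-merge-g18.md` §8–§9).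

Proof (memo §9): family cut lemma (`…FamilyCutLemma`, frame `r ≤ 32c`) → good blocks (`…GoodBlocks`, exceptional set `S`,
`|S| ≤ 10r`) → coarsen `P` to `S ⊔ {∗}` and merge by sequential insertion (`…SequentialInsertion.absoluteMerge_card`, cost
depends on `|S| + 1 ≤ 320c + 1` only) → rank-match the `∗`-cell inside the commutant (`…RankMatching`) → intertwine it with
`P_∗ = Σ_{x∉S} P_x` (`…Intertwiner`) → transport the good cells and the exact family `(G_y P_∗)_y` along the intertwiner.
HONEST FRAMING: negative lane; AMB (linear in c), CoreBE, N0b and the crux stay open; P ≠ NP is not moved; F-N2 is a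
FRONTIER formal rung.
-/

set_option linter.dupNamespace false -- `Summit.PneNP.PneNP.…`: summit = sub-problem name (D-0017)

namespace Summit.PneNP.PneNP.Theorems.CnfIdealGenLengthRankDefectRepresentationsCellAssembly

open Matrix

variable {K : Type} [Field K] {d : ℕ}

/-- **Assembly.**  See the module docstring: the explicitly transported/cut systems are a commuting exact pair. -/
theorem assembly {X Y : Type} [Fintype X] [Fintype Y] [DecidableEq X] [DecidableEq Y]
    (P : X → Matrix (Fin d) (Fin d) K) (Q G : Y → Matrix (Fin d) (Fin d) K) (S : Finset X) (x₁ : X) (hx₁ : x₁ ∈ S)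
    (PcS : S → Matrix (Fin d) (Fin d) K) (E' E'' Tm Ti : Matrix (Fin d) (Fin d) K)
    (hPi : ∀ x, P x * P x = P x) (hPo : ∀ x x', x ≠ x' → P x * P x' = 0)
    (hQi : ∀ y, Q y * Q y = Q y) (hQo : ∀ y y', y ≠ y' → Q y * Q y' = 0) (hQs : ∑ y, Q y = 1)
    (hGcomm : ∀ x y, P x * G y = G y * P x)
    (hgoodS : ∀ x ∉ S, (∀ y y', P x * G y * (P x * G y') = if y = y' then P x * G y else 0) ∧
      P x * (∑ y, G y) = P x)
    (hPcSi : ∀ o, PcS o * PcS o = PcS o) (hPcSo : ∀ o o', o ≠ o' → PcS o * PcS o' = 0)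
    (hE'S : ∀ o, E' * PcS o = 0 ∧ PcS o * E' = 0) (hE'i : E' * E' = E') (hsumS : (∑ o, PcS o) + E' = 1)
    (hPcSQ : ∀ o y, PcS o * Q y = Q y * PcS o) (hE'Q : ∀ y, E' * Q y = Q y * E')
    (hE''i : E'' * E'' = E'') (hE''Q : ∀ y, E'' * Q y = Q y * E'') (hE''S : ∀ o, E'' * PcS o = PcS o * E'')
    (hE'E'' : E' * E'' = E'' * E')
    (hTT : Tm * Ti = 1) (hTT' : Ti * Tm = 1) (hTint : Tm * (∑ x ∈ Sᶜ, P x) = E'' * Tm) :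
    (∀ x, (fun x => if hx : x ∈ S then PcS ⟨x, hx⟩ * (1 - E'') + (if x = x₁ then E' * (1 - E'') else 0)
        else Tm * P x * Ti) x *
      (fun x => if hx : x ∈ S then PcS ⟨x, hx⟩ * (1 - E'') + (if x = x₁ then E' * (1 - E'') else 0)
        else Tm * P x * Ti) x =
      (fun x => if hx : x ∈ S then PcS ⟨x, hx⟩ * (1 - E'') + (if x = x₁ then E' * (1 - E'') else 0)
        else Tm * P x * Ti) x) ∧
    (∀ x x', x ≠ x' →
      (fun x => if hx : x ∈ S then PcS ⟨x, hx⟩ * (1 - E'') + (if x = x₁ then E' * (1 - E'') else 0)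
        else Tm * P x * Ti) x *
      (fun x => if hx : x ∈ S then PcS ⟨x, hx⟩ * (1 - E'') + (if x = x₁ then E' * (1 - E'') else 0)
        else Tm * P x * Ti) x' = 0) ∧
    (∑ x, (fun x => if hx : x ∈ S then PcS ⟨x, hx⟩ * (1 - E'') + (if x = x₁ then E' * (1 - E'') else 0)
        else Tm * P x * Ti) x = 1) ∧
    (∀ y y', (Q y * (1 - E'') + Tm * (G y * ∑ x ∈ Sᶜ, P x) * Ti) * (Q y' * (1 - E'') + Tm * (G y' * ∑ x ∈ Sᶜ, P x) * Ti) =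
      if y = y' then Q y * (1 - E'') + Tm * (G y * ∑ x ∈ Sᶜ, P x) * Ti else 0) ∧
    (∑ y, (Q y * (1 - E'') + Tm * (G y * ∑ x ∈ Sᶜ, P x) * Ti) = 1) ∧
    (∀ x y, (fun x => if hx : x ∈ S then PcS ⟨x, hx⟩ * (1 - E'') + (if x = x₁ then E' * (1 - E'') else 0)
        else Tm * P x * Ti) x * (Q y * (1 - E'') + Tm * (G y * ∑ x ∈ Sᶜ, P x) * Ti) =
      (Q y * (1 - E'') + Tm * (G y * ∑ x ∈ Sᶜ, P x) * Ti) *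
      (fun x => if hx : x ∈ S then PcS ⟨x, hx⟩ * (1 - E'') + (if x = x₁ then E' * (1 - E'') else 0)
        else Tm * P x * Ti) x) := by
  classical
  set Pstar : Matrix (Fin d) (Fin d) K := ∑ x ∈ Sᶜ, P x with hPstar
  have hPu := Summit.PneNP.PneNP.Theorems.CnfIdealGenLengthRankDefectRepresentationsPolyOfAbsoluteMergeLevels.cells_sum_mul_sum
    P hPi hPo
  have hPstar_idem : Pstar * Pstar = Pstar := by rw [hPstar, hPu, Finset.inter_self]
  have hPstar_good : ∀ x ∉ S, Pstar * P x = P x ∧ P x * Pstar = P x := by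
    intro x hx
    have hxc : x ∈ Sᶜ := Finset.mem_compl.mpr hx
    have h1 : (∑ x' ∈ Sᶜ, P x') * (∑ x' ∈ ({x} : Finset X), P x') = P x := by
      rw [hPu, Finset.inter_singleton_of_mem hxc, Finset.sum_singleton]
    have h2 : (∑ x' ∈ ({x} : Finset X), P x') * (∑ x' ∈ Sᶜ, P x') = P x := by
      rw [hPu, Finset.singleton_inter_of_mem hxc, Finset.sum_singleton]
    rw [Finset.sum_singleton] at h1 h2
    exact ⟨h1, h2⟩
  have hprod : ∀ x y y', P x * G y * (P x * G y') = P x * (G y * G y') := by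
    intro x y y'
    calc P x * G y * (P x * G y') = P x * ((G y * P x) * G y') := by simp only [Matrix.mul_assoc]
      _ = P x * ((P x * G y) * G y') := by rw [hGcomm]
      _ = (P x * P x) * (G y * G y') := by simp only [Matrix.mul_assoc]
      _ = P x * (G y * G y') := by rw [hPi]
  have hTconj : Tm * Pstar * Ti = E'' := by rw [hTint, Matrix.mul_assoc, hTT, Matrix.mul_one]
  -- names as in the monolithic proof
  set Lft : Matrix (Fin d) (Fin d) K := E' * (1 - E'') with hLft
  set Acell : S → Matrix (Fin d) (Fin d) K := fun o => PcS o * (1 - E'') with hAcell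
  set P' : X → Matrix (Fin d) (Fin d) K := fun x =>
    if hx : x ∈ S then PcS ⟨x, hx⟩ * (1 - E'') + (if x = x₁ then E' * (1 - E'') else 0) else Tm * P x * Ti with hP'
  set Q' : Y → Matrix (Fin d) (Fin d) K := fun y => Q y * (1 - E'') + Tm * (G y * Pstar) * Ti with hQ'
  show (∀ x, P' x * P' x = P' x) ∧ (∀ x x', x ≠ x' → P' x * P' x' = 0) ∧ ∑ x, P' x = 1 ∧
    (∀ y y', Q' y * Q' y' = if y = y' then Q' y else 0) ∧ ∑ y, Q' y = 1 ∧ ∀ x y, P' x * Q' y = Q' y * P' x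
  -- algebra of the pieces
  have hIE : (1 - E'') * (1 - E'') = (1 : Matrix (Fin d) (Fin d) K) - E'' := by
    simp only [Matrix.sub_mul, Matrix.mul_sub, Matrix.one_mul, Matrix.mul_one, hE''i]; abel
  have hcQ : ∀ y, (1 - E'') * Q y = Q y * (1 - E'') := fun y => by
    simp only [Matrix.sub_mul, Matrix.mul_sub, Matrix.one_mul, Matrix.mul_one, hE''Q]
  have hcPc : ∀ o, (1 - E'') * PcS o = PcS o * (1 - E'') := fun o => by
    simp only [Matrix.sub_mul, Matrix.mul_sub, Matrix.one_mul, Matrix.mul_one, hE''S]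
  have hcE' : (1 - E'') * E' = E' * (1 - E'') := by
    simp only [Matrix.sub_mul, Matrix.mul_sub, Matrix.one_mul, Matrix.mul_one, hE'E'']
  have hE''I : E'' * (1 - E'') = 0 := by rw [Matrix.mul_sub, Matrix.mul_one, hE''i, sub_self]
  have hIE'' : (1 - E'') * E'' = 0 := by rw [Matrix.sub_mul, Matrix.one_mul, hE''i, sub_self]
  have hLft_i : Lft * Lft = Lft := by
    show E' * (1 - E'') * (E' * (1 - E'')) = E' * (1 - E'')
    rw [Matrix.mul_assoc, ← Matrix.mul_assoc (1 - E''), hcE', Matrix.mul_assoc, hIE, ← Matrix.mul_assoc, hE'i]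
  have hA_i : ∀ o, Acell o * Acell o = Acell o := by
    intro o
    show PcS o * (1 - E'') * (PcS o * (1 - E'')) = PcS o * (1 - E'')
    rw [Matrix.mul_assoc, ← Matrix.mul_assoc (1 - E''), hcPc, Matrix.mul_assoc, hIE, ← Matrix.mul_assoc, hPcSi]
  have hA_o : ∀ o o', o ≠ o' → Acell o * Acell o' = 0 := by
    intro o o' h
    show PcS o * (1 - E'') * (PcS o' * (1 - E'')) = 0
    rw [Matrix.mul_assoc, ← Matrix.mul_assoc (1 - E''), hcPc, ← Matrix.mul_assoc, ← Matrix.mul_assoc,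
      hPcSo o o' h, Matrix.zero_mul, Matrix.zero_mul]
  have hA_L : ∀ o, Acell o * Lft = 0 ∧ Lft * Acell o = 0 := by
    intro o
    constructor
    · show PcS o * (1 - E'') * (E' * (1 - E'')) = 0
      rw [Matrix.mul_assoc, ← Matrix.mul_assoc (1 - E''), hcE', ← Matrix.mul_assoc, ← Matrix.mul_assoc,
        (hE'S o).2, Matrix.zero_mul, Matrix.zero_mul]
    · show E' * (1 - E'') * (PcS o * (1 - E'')) = 0
      rw [Matrix.mul_assoc, ← Matrix.mul_assoc (1 - E''), hcPc, ← Matrix.mul_assoc, ← Matrix.mul_assoc,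
        (hE'S o).1, Matrix.zero_mul, Matrix.zero_mul]
  -- sums of the S-cells
  have hA_sum : (∑ o : S, Acell o) + Lft = 1 - E'' := by
    show (∑ o : S, PcS o * (1 - E'')) + E' * (1 - E'') = 1 - E''
    rw [← Finset.sum_mul, ← Matrix.add_mul]
    have : (∑ o : S, PcS o) + E' = 1 := hsumS
    rw [this, Matrix.one_mul]
  -- the good cells
  have hgoodT : ∀ x ∉ S, Tm * P x * Ti = E'' * (Tm * P x * Ti) ∧ Tm * P x * Ti = Tm * P x * Ti * E'' := by
    intro x hx
    constructor
    · calc Tm * P x * Ti = Tm * Pstar * P x * Ti := by rw [Matrix.mul_assoc Tm Pstar (P x), (hPstar_good x hx).1]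
        _ = E'' * Tm * P x * Ti := by rw [hTint]
        _ = E'' * (Tm * P x * Ti) := by simp only [Matrix.mul_assoc]
    · calc Tm * P x * Ti = Tm * P x * Pstar * Ti := by rw [Matrix.mul_assoc Tm (P x) Pstar, (hPstar_good x hx).2]
        _ = Tm * P x * (Ti * Tm) * Pstar * Ti := by rw [hTT', Matrix.mul_one]
        _ = Tm * P x * Ti * (Tm * Pstar * Ti) := by simp only [Matrix.mul_assoc]
        _ = Tm * P x * Ti * E'' := by rw [hTconj]
  have hP'S : ∀ x (hx : x ∈ S), P' x = Acell ⟨x, hx⟩ + (if x = x₁ then Lft else 0) := fun x hx => dif_pos hx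
  have hP'G : ∀ x, x ∉ S → P' x = Tm * P x * Ti := fun x hx => dif_neg hx
  -- orthogonality between a matrix "inside `1 − E''`" and one "inside `E''`"
  have hkill : ∀ (M N : Matrix (Fin d) (Fin d) K), M = M * (1 - E'') → N = E'' * N → M * N = 0 := by
    intro M N hM hN
    rw [hM, hN, Matrix.mul_assoc, ← Matrix.mul_assoc (1 - E''), hIE'', Matrix.zero_mul, Matrix.mul_zero]
  have hkill' : ∀ (M N : Matrix (Fin d) (Fin d) K), M = M * E'' → N = (1 - E'') * N → M * N = 0 := by
    intro M N hM hN
    rw [hM, hN, Matrix.mul_assoc, ← Matrix.mul_assoc E'', hE''I, Matrix.zero_mul, Matrix.mul_zero]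
  have hA_right : ∀ o, Acell o = Acell o * (1 - E'') := fun o => by
    show _ = PcS o * (1 - E'') * (1 - E''); rw [Matrix.mul_assoc, hIE]
  have hA_left : ∀ o, Acell o = (1 - E'') * Acell o := fun o => by
    show PcS o * (1 - E'') = (1 - E'') * (PcS o * (1 - E''))
    rw [← Matrix.mul_assoc, hcPc, Matrix.mul_assoc, hIE]
  have hL_right : Lft = Lft * (1 - E'') := by show _ = E' * (1 - E'') * (1 - E''); rw [Matrix.mul_assoc, hIE]
  have hL_left : Lft = (1 - E'') * Lft := by
    show E' * (1 - E'') = (1 - E'') * (E' * (1 - E''))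
    rw [← Matrix.mul_assoc, hcE', Matrix.mul_assoc, hIE]
  have hSblock_right : ∀ x (hx : x ∈ S), P' x = P' x * (1 - E'') := by
    intro x hx
    rw [hP'S x hx, Matrix.add_mul, ← hA_right]
    congr 1
    split_ifs
    · exact hL_right
    · rw [Matrix.zero_mul]
  have hSblock_left : ∀ x (hx : x ∈ S), P' x = (1 - E'') * P' x := by
    intro x hx
    rw [hP'S x hx, Matrix.mul_add, ← hA_left]
    congr 1
    split_ifs
    · exact hL_left
    · rw [Matrix.mul_zero]
  have hgood_right : ∀ x, x ∉ S → P' x = P' x * E'' := fun x hx => by rw [hP'G x hx]; exact (hgoodT x hx).2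
  have hgood_left : ∀ x, x ∉ S → P' x = E'' * P' x := fun x hx => by rw [hP'G x hx]; exact (hgoodT x hx).1
  -- P' is exact
  have hP'i : ∀ x, P' x * P' x = P' x := by
    intro x
    by_cases hx : x ∈ S
    · rw [hP'S x hx]
      by_cases h1 : x = x₁
      · rw [if_pos h1, Matrix.add_mul, Matrix.mul_add, Matrix.mul_add, hA_i, (hA_L _).1, (hA_L _).2, hLft_i]; abel
      · rw [if_neg h1, add_zero, hA_i]
    · rw [hP'G x hx]
      calc Tm * P x * Ti * (Tm * P x * Ti) = Tm * P x * (Ti * Tm) * P x * Ti := by simp only [Matrix.mul_assoc]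
        _ = Tm * P x * Ti := by rw [hTT', Matrix.mul_one, Matrix.mul_assoc Tm (P x) (P x), hPi]
  have hP'o : ∀ x x', x ≠ x' → P' x * P' x' = 0 := by
    intro x x' hxx'
    by_cases hx : x ∈ S
    · by_cases hx' : x' ∈ S
      · rw [hP'S x hx, hP'S x' hx']
        have hne : (⟨x, hx⟩ : S) ≠ ⟨x', hx'⟩ := fun e => hxx' (Subtype.ext_iff.mp e)
        by_cases h1 : x = x₁
        · have h1' : x' ≠ x₁ := fun e => hxx' (h1.trans e.symm)
          rw [if_pos h1, if_neg h1', add_zero, Matrix.add_mul, hA_o _ _ hne, (hA_L _).2, add_zero]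
        · by_cases h1' : x' = x₁
          · rw [if_neg h1, if_pos h1', add_zero, Matrix.mul_add, hA_o _ _ hne, (hA_L _).1, add_zero]
          · rw [if_neg h1, if_neg h1', add_zero, add_zero, hA_o _ _ hne]
      · exact hkill _ _ (hSblock_right x hx) (hgood_left x' hx')
    · by_cases hx' : x' ∈ S
      · exact hkill' _ _ (hgood_right x hx) (hSblock_left x' hx')
      · rw [hP'G x hx, hP'G x' hx']
        calc Tm * P x * Ti * (Tm * P x' * Ti) = Tm * P x * (Ti * Tm) * P x' * Ti := by simp only [Matrix.mul_assoc]
          _ = 0 := by rw [hTT', Matrix.mul_one, Matrix.mul_assoc Tm (P x), hPo x x' hxx', Matrix.mul_zero,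
              Matrix.zero_mul]
  have hP's : ∑ x, P' x = 1 := by
    rw [← Finset.sum_filter_add_sum_filter_not Finset.univ (fun x => x ∈ S)]
    have hS' : Finset.univ.filter (fun x => x ∈ S) = S := by ext x; simp
    have hSc' : Finset.univ.filter (fun x => ¬ x ∈ S) = Sᶜ := by ext x; simp
    rw [hS', hSc']
    have h1 : ∑ x ∈ S, P' x = (∑ o : S, Acell o) + Lft := by
      rw [← Finset.sum_coe_sort S]
      have : ∀ o : S, P' o = Acell o + (if o = ⟨x₁, hx₁⟩ then Lft else 0) := fun o => by
        rw [hP'S o o.2]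
        congr 1
        by_cases h : (o : X) = x₁
        · rw [if_pos h, if_pos (Subtype.ext h)]
        · rw [if_neg h, if_neg (fun e => h (congrArg Subtype.val e))]
      simp_rw [this]
      rw [Finset.sum_add_distrib, Finset.sum_ite_eq' Finset.univ (⟨x₁, hx₁⟩ : S)]
      simp
    have h2 : ∑ x ∈ Sᶜ, P' x = Tm * Pstar * Ti := by
      show ∑ x ∈ Sᶜ, P' x = Tm * (∑ x ∈ Sᶜ, P x) * Ti
      rw [Finset.mul_sum, Finset.sum_mul]
      exact Finset.sum_congr rfl fun x hx => hP'G x (Finset.mem_compl.mp hx)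
    rw [h1, h2, hA_sum, hTconj, sub_add_cancel]
  -- good-block identities for `G`
  have hGPstar : ∀ y, G y * Pstar = Pstar * G y := by
    intro y
    show G y * (∑ x ∈ Sᶜ, P x) = (∑ x ∈ Sᶜ, P x) * G y
    rw [Finset.mul_sum, Finset.sum_mul]
    exact Finset.sum_congr rfl fun x _ => (hGcomm x y).symm
  have hGexact : ∀ y y', G y * Pstar * (G y' * Pstar) = if y = y' then G y * Pstar else 0 := by
    intro y y'
    have hpair : ∀ x x', G y * P x * (G y' * P x') = if x = x' then P x * G y * (P x * G y') else 0 := by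
      intro x x'
      have e : G y * P x * (G y' * P x') = (P x * P x') * (G y * G y') := by
        calc G y * P x * (G y' * P x') = P x * G y * (P x' * G y') := by rw [hGcomm, hGcomm]
          _ = P x * (G y * P x') * G y' := by simp only [Matrix.mul_assoc]
          _ = P x * (P x' * G y) * G y' := by rw [hGcomm]
          _ = (P x * P x') * (G y * G y') := by simp only [Matrix.mul_assoc]
      rw [e]
      by_cases h : x = x'
      · subst h; rw [if_pos rfl, hPi, hprod]
      · rw [if_neg h, hPo x x' h, Matrix.zero_mul]
    have e2 : G y * Pstar * (G y' * Pstar) = ∑ x ∈ Sᶜ, P x * G y * (P x * G y') := by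
      show G y * (∑ x ∈ Sᶜ, P x) * (G y' * ∑ x ∈ Sᶜ, P x) = _
      rw [Finset.mul_sum, Finset.mul_sum, Finset.sum_mul]
      refine Finset.sum_congr rfl fun x hx => ?_
      rw [Finset.mul_sum, Finset.sum_eq_single x]
      · rw [hpair, if_pos rfl]
      · intro x' _ hx'; rw [hpair, if_neg (Ne.symm hx')]
      · intro h; exact absurd hx h
    rw [e2, Finset.sum_congr rfl fun x hx => (hgoodS x (Finset.mem_compl.mp hx)).1 y y']
    split_ifs with h
    · -- `∑_{x ∈ Sᶜ} P_x G_y = Pstar G_y = G_y Pstar`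
      rw [← Finset.sum_mul]
      exact (hGPstar y).symm
    · simp
  have hGsum : ∑ y, G y * Pstar = Pstar := by
    rw [← Finset.sum_mul]
    show (∑ y, G y) * (∑ x ∈ Sᶜ, P x) = ∑ x ∈ Sᶜ, P x
    rw [Finset.mul_sum]
    refine Finset.sum_congr rfl fun x hx => ?_
    have h := (hgoodS x (Finset.mem_compl.mp hx)).2
    rw [Finset.mul_sum] at h
    rw [Finset.sum_mul]
    calc ∑ y, G y * P x = ∑ y, P x * G y := Finset.sum_congr rfl fun y _ => (hGcomm x y).symm
      _ = P x := h
  -- the transported good part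
  set Bq : Y → Matrix (Fin d) (Fin d) K := fun y => Tm * (G y * Pstar) * Ti with hBq
  have hBq_i : ∀ y y', Bq y * Bq y' = if y = y' then Bq y else 0 := by
    intro y y'
    show Tm * (G y * Pstar) * Ti * (Tm * (G y' * Pstar) * Ti) = _
    calc Tm * (G y * Pstar) * Ti * (Tm * (G y' * Pstar) * Ti)
        = Tm * (G y * Pstar) * (Ti * Tm) * (G y' * Pstar) * Ti := by simp only [Matrix.mul_assoc]
      _ = Tm * (G y * Pstar * (G y' * Pstar)) * Ti := by rw [hTT', Matrix.mul_one]; simp only [Matrix.mul_assoc]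
      _ = _ := by rw [hGexact]; split_ifs <;> simp [hBq]
  have hBq_s : ∑ y, Bq y = E'' := by
    show ∑ y, Tm * (G y * Pstar) * Ti = E''
    rw [← Finset.sum_mul, ← Finset.mul_sum, hGsum, hTconj]
  have hBq_E : ∀ y, Bq y = E'' * Bq y ∧ Bq y = Bq y * E'' := by
    intro y
    constructor
    · show Tm * (G y * Pstar) * Ti = E'' * (Tm * (G y * Pstar) * Ti)
      rw [← hTconj]
      calc Tm * (G y * Pstar) * Ti = Tm * (Pstar * (G y * Pstar)) * Ti := by
            rw [← Matrix.mul_assoc Pstar, ← hGPstar, Matrix.mul_assoc (G y), hPstar_idem]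
        _ = Tm * Pstar * (Ti * Tm) * (G y * Pstar) * Ti := by rw [hTT', Matrix.mul_one]; simp only [Matrix.mul_assoc]
        _ = Tm * Pstar * Ti * (Tm * (G y * Pstar) * Ti) := by simp only [Matrix.mul_assoc]
    · show Tm * (G y * Pstar) * Ti = Tm * (G y * Pstar) * Ti * E''
      rw [← hTconj]
      calc Tm * (G y * Pstar) * Ti = Tm * (G y * Pstar * Pstar) * Ti := by rw [Matrix.mul_assoc (G y), hPstar_idem]
        _ = Tm * (G y * Pstar) * (Ti * Tm) * Pstar * Ti := by rw [hTT', Matrix.mul_one]; simp only [Matrix.mul_assoc]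
        _ = Tm * (G y * Pstar) * Ti * (Tm * Pstar * Ti) := by simp only [Matrix.mul_assoc]
  have hQI : ∀ y, Q y * (1 - E'') = (1 - E'') * (Q y * (1 - E'')) ∧ Q y * (1 - E'') = Q y * (1 - E'') * (1 - E'') := by
    intro y
    constructor
    · rw [← Matrix.mul_assoc, hcQ, Matrix.mul_assoc, hIE]
    · rw [Matrix.mul_assoc, hIE]
  -- Q' is exact
  have hQ'i : ∀ y y', Q' y * Q' y' = if y = y' then Q' y else 0 := by
    intro y y'
    show (Q y * (1 - E'') + Bq y) * (Q y' * (1 - E'') + Bq y') = if y = y' then Q y * (1 - E'') + Bq y else 0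
    rw [Matrix.add_mul, Matrix.mul_add, Matrix.mul_add,
      hkill _ _ (hQI y).2 (hBq_E y').1, hkill' _ _ (hBq_E y).2 (hQI y').1, add_zero, zero_add, hBq_i]
    have : Q y * (1 - E'') * (Q y' * (1 - E'')) = if y = y' then Q y * (1 - E'') else 0 := by
      have e : Q y * (1 - E'') * (Q y' * (1 - E'')) = Q y * Q y' * (1 - E'') := by
        calc Q y * (1 - E'') * (Q y' * (1 - E'')) = Q y * ((1 - E'') * Q y') * (1 - E'') := by
              simp only [Matrix.mul_assoc]
          _ = Q y * (Q y' * (1 - E'')) * (1 - E'') := by rw [hcQ]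
          _ = Q y * Q y' * ((1 - E'') * (1 - E'')) := by simp only [Matrix.mul_assoc]
          _ = Q y * Q y' * (1 - E'') := by rw [hIE]
      rw [e]
      by_cases h : y = y'
      · subst h; rw [if_pos rfl, hQi]
      · rw [if_neg h, hQo y y' h, Matrix.zero_mul]
    rw [this]
    split_ifs <;> simp
  have hQ's : ∑ y, Q' y = 1 := by
    show ∑ y, (Q y * (1 - E'') + Bq y) = 1
    rw [Finset.sum_add_distrib, ← Finset.sum_mul, hQs, Matrix.one_mul, hBq_s, sub_add_cancel]
  -- commutation
  have hcommPQ : ∀ x y, P' x * Q' y = Q' y * P' x := by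
    intro x y
    show P' x * (Q y * (1 - E'') + Bq y) = (Q y * (1 - E'') + Bq y) * P' x
    by_cases hx : x ∈ S
    · rw [Matrix.mul_add, Matrix.add_mul, hkill _ _ (hSblock_right x hx) (hBq_E y).1,
        hkill' _ _ (hBq_E y).2 (hSblock_left x hx), add_zero, add_zero]
      -- S-cells commute with `Q_y (1 − E'')`: they are built from `Pc'`, `E'`, `E''`, all in the commutant of `Q`
      have hAQ : ∀ o, Acell o * Q y = Q y * Acell o := by
        intro o
        show PcS o * (1 - E'') * Q y = Q y * (PcS o * (1 - E''))
        rw [Matrix.mul_assoc, hcQ, ← Matrix.mul_assoc, hPcSQ, Matrix.mul_assoc]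
      have hLQ : Lft * Q y = Q y * Lft := by
        show E' * (1 - E'') * Q y = Q y * (E' * (1 - E''))
        rw [Matrix.mul_assoc, hcQ, ← Matrix.mul_assoc, hE'Q, Matrix.mul_assoc]
      have hPQ : P' x * Q y = Q y * P' x := by
        rw [hP'S x hx, Matrix.add_mul, Matrix.mul_add, hAQ]
        congr 1
        split_ifs
        · exact hLQ
        · rw [Matrix.zero_mul, Matrix.mul_zero]
      have hPE : P' x * (1 - E'') = (1 - E'') * P' x := by rw [← hSblock_right x hx, ← hSblock_left x hx]
      rw [← Matrix.mul_assoc, hPQ, Matrix.mul_assoc, hPE, Matrix.mul_assoc]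
    · rw [Matrix.mul_add, Matrix.add_mul, hkill' _ _ (hgood_right x hx) (hQI y).1,
        hkill _ _ (hQI y).2 (hgood_left x hx), zero_add, zero_add, hP'G x hx]
      show Tm * P x * Ti * (Tm * (G y * Pstar) * Ti) = Tm * (G y * Pstar) * Ti * (Tm * P x * Ti)
      calc Tm * P x * Ti * (Tm * (G y * Pstar) * Ti) = Tm * P x * (Ti * Tm) * (G y * Pstar) * Ti := by
            simp only [Matrix.mul_assoc]
        _ = Tm * (P x * G y * Pstar) * Ti := by rw [hTT', Matrix.mul_one]; simp only [Matrix.mul_assoc]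
        _ = Tm * (G y * Pstar * P x) * Ti := by
            rw [hGcomm x y, Matrix.mul_assoc (G y), (hPstar_good x hx).2, Matrix.mul_assoc (G y),
              (hPstar_good x hx).1]
        _ = Tm * (G y * Pstar) * (Ti * Tm) * P x * Ti := by rw [hTT', Matrix.mul_one]; simp only [Matrix.mul_assoc]
        _ = Tm * (G y * Pstar) * Ti * (Tm * P x * Ti) := by simp only [Matrix.mul_assoc]
  exact ⟨hP'i, hP'o, hP's, hQ'i, hQ's, hcommPQ⟩

end Summit.PneNP.PneNP.Theorems.CnfIdealGenLengthRankDefectRepresentationsCellAssembly
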